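import Summits.NavierStokesRegularity.NavierStokesRegularity.Theorems.ExtremiserTransienceKStarAttainedVariation
import Summits.NavierStokesRegularity.NavierStokesRegularity.Theorems.ExtremiserTransienceKStarAttainedConePotential
import Literature.Analysis.FluidPDE.ConstantinFeffermanEnstrophySlab
import HarnessLib

/-!
# Route `ExtremiserTransience`, support item `KStarAttained` (stmt-NavierStokesRegularity-24370):
# THE TOP-SPEED SET OF A SMOOTH ATTAINER OF `κ⋆` SURROUNDS THE ORIGIN — (1/4) one-sided first variation of an attainer, the law `TopSpeedSurroundsOrigin`, the margin lemma

Part of a 4-file plate (≤ 400 lines each, `lint.statement-form`) prepared by cell seat `nsreg-p3 g21` from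
`HOME/ns-regularity-ideate-p3/round-26/Law26U.lean` (a08432649975ded6); the mathematics, mechanism and the main theorem
`halfSpaceFree_of_attained` are described in the module docstring of file (4/4) `ExtremiserTransienceKStarAttainedHalfSpaceMain`.
Intended landing by a PROVER seat: `--supports stmt-NavierStokesRegularity-24370 --as helper`, files in order 1→4.
-/

noncomputable section

open Set Filter Topology MeasureTheory Metric
open scoped InnerProductSpace RealInnerProductSpace ENNReal NNReal ContDiff
open Literature.Analysis.FluidPDE
open Summit.NavierStokesRegularity.NavierStokesRegularity.Theorems
open Summit.NavierStokesRegularity.NavierStokesRegularity.Theorems.DepletionLadder.KStar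

namespace Summit.NavierStokesRegularity.NavierStokesRegularity.Theorems

-- the problem directory repeats the summit name (`NavierStokesRegularity/NavierStokesRegularity`)
set_option linter.dupNamespace false

namespace DepletionLadder.KStar.HalfSpace

/-- `ℝ³`. -/
abbrev E3 := EuclideanSpace ℝ (Fin 3)

/-- The tree's literal set `V` of universal depletion constants (`…NearExtremalTransienceSharpConstant`). -/
def udcSet : Set ℝ := {κ : ℝ | (∀ (v : EuclideanSpace ℝ (Fin 3) → EuclideanSpace ℝ (Fin 3)) (M B : ℝ), ContDiff ℝ (⊤ : ℕ∞) v → Literature.Analysis.FluidPDE.VectorCalculus.IsDivFree v → (∀ x, ‖v x‖ ≤ M) → (∀ x, ‖fderiv ℝ v x‖ ≤ B) → (∫⁻ x, ‖iteratedFDeriv ℝ 0 v x‖ₑ ^ 2 < ⊤) → (∫⁻ x, ‖iteratedFDeriv ℝ 1 v x‖ₑ ^ 2 < ⊤) → (∫⁻ x, ‖iteratedFDeriv ℝ 2 v x‖ₑ ^ 2 < ⊤) → |∫ x, ⟪Literature.Analysis.FluidPDE.curl v x, fderiv ℝ v x (Literature.Analysis.FluidPDE.curl v x)⟫_ℝ|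 ≤ κ * M * Real.sqrt (∫ x, ‖Literature.Analysis.FluidPDE.curl v x‖ ^ 2) * Real.sqrt (∫ x, Literature.Analysis.FluidPDE.frobeniusNormSq (fderiv ℝ (Literature.Analysis.FluidPDE.curl v) x)))}

/-- `κ⋆ = sInf V`, the sharp depletion constant (tree: `13/200 < κ⋆ ≤ (9+2√15)/42`). -/
def kStar : ℝ := sInf udcSet

variable {v φ : E3 → E3}

/-- Stretching integral `J(v) = ∫⟪ω, Dv ω⟫`. -/
def Jst (v : E3 → E3) : ℝ := ∫ x, ⟪curl v x, fderiv ℝ v x (curl v x)⟫_ℝ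
/-- Enstrophy `Z(v) = ‖ω‖₂²`. -/
def Zen (v : E3 → E3) : ℝ := ∫ x, ‖curl v x‖ ^ 2
/-- Palinstrophy `W(v) = ‖∇ω‖₂²`. -/
def Wpa (v : E3 → E3) : ℝ := ∫ x, frobeniusNormSq (fderiv ℝ (curl v) x)
/-- Linear coefficient of `J` along `v + εφ`. -/
def J1 (v φ : E3 → E3) : ℝ := ∫ x, (⟪curl φ x, fderiv ℝ v x (curl v x)⟫_ℝ + ⟪curl v x, fderiv ℝ φ x (curl v x)⟫_ℝ +
  ⟪curl v x, fderiv ℝ v x (curl φ x)⟫_ℝ)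
/-- Half the linear coefficient of `Z` along `v + εφ`. -/
def A1 (v φ : E3 → E3) : ℝ := ∫ x, ⟪curl v x, curl φ x⟫_ℝ
/-- Half the linear coefficient of `W` along `v + εφ`. -/
def C1 (v φ : E3 → E3) : ℝ := ∫ x, ∑ i, ⟪fderiv ℝ (curl v) x (EuclideanSpace.basisFun (Fin 3) ℝ i),
  fderiv ℝ (curl φ) x (EuclideanSpace.basisFun (Fin 3) ℝ i)⟫_ℝ

/-! ## 1. One-sided Fermat: the linear coefficient of a polynomial `≤ 0` on `[0, ε₁)`, `= 0` at `0`, is `≤ 0` -/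

/-- One-sided version of the tree's `linear_coeff_eq_of_sq_le`: if
`(J + εJ₁ + ε²J₂ + ε³J₃)² ≤ K²((1+mε)M)²(Z + 2εa₁ + ε²a₂)(W + 2εc₁ + ε²c₂)` for `0 ≤ ε < ε₁` with equality at
`ε = 0`, then `J·J₁ ≤ K²M²(m Z W + W a₁ + Z c₁)` (right derivative at a right-sided maximum is `≤ 0`). [folklore] -/
theorem linear_coeff_le_of_sq_le_oneSided {J J₁ J₂ J₃ K M m Z a₁ a₂ W c₁ c₂ ε₁ : ℝ} (hε₁ : 0 < ε₁)
    (hf0 : J ^ 2 = K ^ 2 * M ^ 2 * Z * W)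
    (hle : ∀ ε, 0 ≤ ε → ε < ε₁ → (J + ε * J₁ + ε ^ 2 * J₂ + ε ^ 3 * J₃) ^ 2 ≤
        K ^ 2 * ((1 + m * ε) * M) ^ 2 * (Z + 2 * ε * a₁ + ε ^ 2 * a₂) * (W + 2 * ε * c₁ + ε ^ 2 * c₂)) :
    J * J₁ ≤ K ^ 2 * M ^ 2 * (m * Z * W + W * a₁ + Z * c₁) := by
  set f : ℝ → ℝ := fun ε => (J + ε * J₁ + ε ^ 2 * J₂ + ε ^ 3 * J₃) ^ 2 -
    K ^ 2 * ((1 + m * ε) * M) ^ 2 * (Z + 2 * ε * a₁ + ε ^ 2 * a₂) * (W + 2 * ε * c₁ + ε ^ 2 * c₂) with hf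
  have hf00 : f 0 = 0 := by simp only [hf]; linear_combination hf0
  have hA : HasDerivAt (fun ε : ℝ => J + ε * J₁ + ε ^ 2 * J₂ + ε ^ 3 * J₃) J₁ 0 := by
    have h := ((((hasDerivAt_id' (0 : ℝ)).mul_const J₁).const_add J).add
      ((hasDerivAt_pow 2 (0 : ℝ)).mul_const J₂)).add ((hasDerivAt_pow 3 (0 : ℝ)).mul_const J₃)
    exact h.congr_deriv (by simp)
  have hP : HasDerivAt (fun ε : ℝ => ((1 + m * ε) * M) ^ 2) (2 * m * M ^ 2) 0 := by
    have h := ((((hasDerivAt_id' (0 : ℝ)).const_mul m).const_add 1).mul_const M).pow 2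
    exact h.congr_deriv (by simp; ring)
  have hZ : HasDerivAt (fun ε : ℝ => Z + 2 * ε * a₁ + ε ^ 2 * a₂) (2 * a₁) 0 := by
    have h := (((((hasDerivAt_id' (0 : ℝ)).const_mul 2).mul_const a₁).const_add Z)).add
      ((hasDerivAt_pow 2 (0 : ℝ)).mul_const a₂)
    exact h.congr_deriv (by simp)
  have hW : HasDerivAt (fun ε : ℝ => W + 2 * ε * c₁ + ε ^ 2 * c₂) (2 * c₁) 0 := by
    have h := (((((hasDerivAt_id' (0 : ℝ)).const_mul 2).mul_const c₁).const_add W)).add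
      ((hasDerivAt_pow 2 (0 : ℝ)).mul_const c₂)
    exact h.congr_deriv (by simp)
  have hF : HasDerivAt f (2 * J * J₁ - K ^ 2 * (2 * m * M ^ 2 * Z * W + M ^ 2 * (2 * a₁) * W +
      M ^ 2 * Z * (2 * c₁))) 0 := by
    have h := (hA.pow 2).sub ((((hP.const_mul (K ^ 2)).mul hZ).mul hW))
    exact h.congr_deriv (by simp; ring)
  -- right slopes are `≤ 0`, hence so is the derivative
  have hslope := hF.tendsto_slope_zero_right
  have hev : ∀ᶠ t in 𝓝[>] (0 : ℝ), t⁻¹ • (f (0 + t) - f 0) ≤ 0 := by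
    filter_upwards [Ioo_mem_nhdsGT hε₁] with t ht
    rw [zero_add, hf00, sub_zero, smul_eq_mul]
    have hft : f t ≤ 0 := by
      have := hle t ht.1.le ht.2
      simp only [hf]
      linarith
    exact mul_nonpos_of_nonneg_of_nonpos (inv_nonneg.2 ht.1.le) hft
  have hD := le_of_tendsto hslope hev
  linarith

/-! ## 2. The one-sided first variation of an attainer (`ε ≥ 0`, any real `m`) -/

/-- **One-sided first variation of an attainer.** As the tree's `firstVariation_eq_of_normBound`, but the norm
bound `‖v + εφ‖ ≤ (1 + mε)·M` is assumed only for `0 ≤ ε < ε₀` (so `m < 0` is allowed): then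
`J·J₁(φ) ≤ κ⋆²·M²·(m·Z·W + W·a₁(φ) + Z·c₁(φ))`.  (Universality of `κ⋆`, `sharpDepletion_is_universal`, applied to
the admissible `v + εφ` with bound `(1+mε)M`; polynomial expansions `integral_*_add_smul`; one-sided Fermat.) [folklore] -/
theorem firstVariation_le_of_oneSided_normBound (hv : ContDiff ℝ ∞ v) (hdiv : VectorCalculus.IsDivFree v)
    {M B : ℝ} (hB : ∀ x, ‖fderiv ℝ v x‖ ≤ B) (h0 : ∫⁻ x, ‖iteratedFDeriv ℝ 0 v x‖ₑ ^ 2 < ⊤)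
    (h1 : ∫⁻ x, ‖iteratedFDeriv ℝ 1 v x‖ₑ ^ 2 < ⊤) (h2 : ∫⁻ x, ‖iteratedFDeriv ℝ 2 v x‖ₑ ^ 2 < ⊤)
    (hatt : |Jst v| = kStar * M * Real.sqrt (Zen v) * Real.sqrt (Wpa v))
    (hφ : ContDiff ℝ ∞ φ) (hφc : HasCompactSupport φ) (hφdiv : VectorCalculus.IsDivFree φ)
    {m ε₀ : ℝ} (hε₀ : 0 < ε₀)
    (hbound : ∀ ε : ℝ, 0 ≤ ε → ε < ε₀ → ∀ x, ‖v x + ε • φ x‖ ≤ (1 + m * ε) * M) :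
    Jst v * J1 v φ ≤ kStar ^ 2 * M ^ 2 * (m * Zen v * Wpa v + Wpa v * A1 v φ + Zen v * C1 v φ) := by
  have huniv := DepletionLadder.sharpDepletion_is_universal
  have hZ0 : 0 ≤ Zen v := integral_nonneg fun x => sq_nonneg _
  have hW0 : 0 ≤ Wpa v := integral_nonneg fun x => frobeniusNormSq_nonneg _
  refine linear_coeff_le_of_sq_le_oneSided hε₀
    (J₂ := ∫ x, (⟪curl φ x, fderiv ℝ φ x (curl v x)⟫ + ⟪curl φ x, fderiv ℝ v x (curl φ x)⟫ +
      ⟪curl v x, fderiv ℝ φ x (curl φ x)⟫))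
    (J₃ := ∫ x, ⟪curl φ x, fderiv ℝ φ x (curl φ x)⟫) (a₂ := ∫ x, ‖curl φ x‖ ^ 2)
    (c₂ := ∫ x, frobeniusNormSq (fderiv ℝ (curl φ) x)) ?_ fun ε hε0 hε => ?_
  · calc Jst v ^ 2 = |Jst v| ^ 2 := (sq_abs _).symm
      _ = (kStar * M * Real.sqrt (Zen v) * Real.sqrt (Wpa v)) ^ 2 := by rw [hatt]
      _ = kStar ^ 2 * M ^ 2 * Zen v * Wpa v := by
          rw [mul_pow, mul_pow, mul_pow, Real.sq_sqrt hZ0, Real.sq_sqrt hW0]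
  · obtain ⟨hcd, hdv, ⟨B', hB'⟩, h0', h1', h2'⟩ := admissible_add_smul hv hdiv hB h0 h1 h2 hφ hφc hφdiv ε
    have hu := huniv _ ((1 + m * ε) * M) B' hcd hdv (hbound ε hε0 hε) hB' h0' h1' h2'
    have hZε : 0 ≤ ∫ x, ‖curl (fun y => v y + ε • φ y) x‖ ^ 2 := integral_nonneg fun x => sq_nonneg _
    have hWε : 0 ≤ ∫ x, frobeniusNormSq (fderiv ℝ (curl (fun y => v y + ε • φ y)) x) :=
      integral_nonneg fun x => frobeniusNormSq_nonneg _
    have hsq : (∫ x, ⟪curl (fun y => v y + ε • φ y) x,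
        fderiv ℝ (fun y => v y + ε • φ y) x (curl (fun y => v y + ε • φ y) x)⟫) ^ 2 ≤
        (kStar * ((1 + m * ε) * M) * Real.sqrt (∫ x, ‖curl (fun y => v y + ε • φ y) x‖ ^ 2) *
          Real.sqrt (∫ x, frobeniusNormSq (fderiv ℝ (curl (fun y => v y + ε • φ y)) x))) ^ 2 := by
      rw [← sq_abs (∫ x, ⟪curl (fun y => v y + ε • φ y) x,
        fderiv ℝ (fun y => v y + ε • φ y) x (curl (fun y => v y + ε • φ y) x)⟫)]
      exact pow_le_pow_left₀ (abs_nonneg _) hu 2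
    rw [mul_pow, mul_pow, mul_pow, Real.sq_sqrt hZε, Real.sq_sqrt hWε,
      integral_stretching_add_smul hv hB h1 hφ hφc ε, integral_normSq_curl_add_smul hv h1 hφ hφc ε,
      integral_frobeniusNormSq_add_smul hv h2 hφ hφc ε] at hsq
    exact hsq

/-! ## 3. The law, its two analytic inputs, and the kernel-checked composition -/

/-- `HalfSpaceFree v M`: for every direction `t` some top-speed point has `⟪v x, t⟫ ≥ 0` — the top-speed velocity set
`{v x : ‖v x‖ = M}` is contained in no open half-space `{⟪·, t⟫ < 0}` (equivalently, when it is nonempty and compact,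
`0 ∈ conv {v x : ‖v x‖ = M}`). -/
def HalfSpaceFree (v : E3 → E3) (M : ℝ) : Prop := ∀ t : E3, ∃ x, ‖v x‖ = M ∧ 0 ≤ ⟪v x, t⟫_ℝ

/-- **THE LAW (ROUND-26 exact statement).** Every admissible, non-degenerate attainer of `κ⋆` is `HalfSpaceFree`:
its top-speed velocities surround the origin.  (Binders = the tree's admissibility literal of `KStar.interior_contact_nonempty`.) -/
def TopSpeedSurroundsOrigin : Prop :=
  ∀ (v : E3 → E3) (M B : ℝ), ContDiff ℝ ∞ v → VectorCalculus.IsDivFree v → (∀ x, ‖v x‖ ≤ M) →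
    (∀ x, ‖fderiv ℝ v x‖ ≤ B) → (∫⁻ x, ‖iteratedFDeriv ℝ 0 v x‖ₑ ^ 2 < ⊤) →
    (∫⁻ x, ‖iteratedFDeriv ℝ 1 v x‖ₑ ^ 2 < ⊤) → (∫⁻ x, ‖iteratedFDeriv ℝ 2 v x‖ₑ ^ 2 < ⊤) →
    0 < M * Real.sqrt (Zen v) * Real.sqrt (Wpa v) →
    |Jst v| = kStar * M * Real.sqrt (Zen v) * Real.sqrt (Wpa v) → HalfSpaceFree v M

/-- **Analytic input A (wide weak fields; paper proof ROUND-26 §2(A)).** For admissible `v`, every `t`, every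
`θ > 0` and every `L₀` there are `L ≥ L₀` and a `C^∞_c` divergence-free `φ` with `φ = t` on the ball `‖x‖ < L`
and `|J₁(φ)|, |a₁(φ)|, |c₁(φ)| ≤ θ` (REDUCED below to the pure estimate `WideFieldEstimates` for the explicit family
`wideField t L = curl (χ_L · ½ t × x)`, whose qualitative properties are PROVED in `wideField_props`).  Witness: `φ_L = curl (χ_L · ½ t × x)` with a radial
bump `χ_L` (`= 1` on `B_L`, `= 0` off `B_{2L}`, `|∇χ_L| ≤ 2/L`): `a₁ = ∫⟪v, curl curl φ_L⟫ = O(‖v‖_{L²(B_{2L}∖B_L)}·L^{-1/2})`,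
`c₁ = O(‖∇ω‖_{L²(shell)}·L^{-1/2})`, `J₁ = O(L⁻¹·(‖Dv‖_{L²(shell)}‖ω‖_{L²(shell)} + ‖ω‖²_{L²(shell)}))`, all `→ 0`. -/
def WideFieldVanishing : Prop :=
  ∀ (v : E3 → E3) (M B : ℝ), ContDiff ℝ ∞ v → VectorCalculus.IsDivFree v → (∀ x, ‖v x‖ ≤ M) →
    (∀ x, ‖fderiv ℝ v x‖ ≤ B) → (∫⁻ x, ‖iteratedFDeriv ℝ 0 v x‖ₑ ^ 2 < ⊤) →
    (∫⁻ x, ‖iteratedFDeriv ℝ 1 v x‖ₑ ^ 2 < ⊤) → (∫⁻ x, ‖iteratedFDeriv ℝ 2 v x‖ₑ ^ 2 < ⊤) →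
    ∀ (t : E3) (θ : ℝ), 0 < θ → ∀ L₀ : ℝ, ∃ L : ℝ, L₀ ≤ L ∧ ∃ φ : E3 → E3,
      ContDiff ℝ ∞ φ ∧ HasCompactSupport φ ∧ VectorCalculus.IsDivFree φ ∧
      (∀ x, ‖x‖ < L → φ x = t) ∧ |J1 v φ| ≤ θ ∧ |A1 v φ| ≤ θ ∧ |C1 v φ| ≤ θ

/-- **Analytic input B (margin; pure topology, PROVED below as `halfSpaceMargin_holds`).** If every top-speed velocity
has `⟪v x, t⟫ < 0`, then by compactness of the contact set and decay of `v` there are `η, γ > 0` and a radius `R₁` with: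
`‖v x‖ ≥ M − η ⇒ ‖x‖ < R₁` and `⟪v x, t⟫ ≤ −γ`. -/
def HalfSpaceMargin : Prop :=
  ∀ (v : E3 → E3) (M B : ℝ), ContDiff ℝ ∞ v → (∀ x, ‖v x‖ ≤ M) → (∀ x, ‖fderiv ℝ v x‖ ≤ B) →
    (∫⁻ x, ‖iteratedFDeriv ℝ 0 v x‖ₑ ^ 2 < ⊤) → 0 < M → ∀ t : E3,
    (∀ x, ‖v x‖ = M → ⟪v x, t⟫_ℝ < 0) →
    ∃ η γ R₁ : ℝ, 0 < η ∧ 0 < γ ∧ (∀ x, M - η ≤ ‖v x‖ → ‖x‖ < R₁) ∧ (∀ x, M - η ≤ ‖v x‖ → ⟪v x, t⟫_ℝ ≤ -γ)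

/-- **Input B holds** (compactness of the contact set, decay of `v` at infinity via the tree's
`KStar.exists_radius_norm_lt`, and two max-attainment arguments). [folklore] -/
theorem halfSpaceMargin_holds : HalfSpaceMargin := by
  intro v M B hv hM hB h0 hMpos t hneg
  obtain ⟨R, -, hR⟩ := exists_radius_norm_lt hv hB h0 (half_pos hMpos)
  have hvc : Continuous v := hv.continuous
  have hgc : Continuous fun x => ⟪v x, t⟫_ℝ := hvc.inner continuous_const
  have hnc : Continuous fun x => ‖v x‖ := continuous_norm.comp hvc
  -- the contact set is compact
  have hKc : IsCompact {x : E3 | ‖v x‖ = M} := by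
    refine isCompact_of_isClosed_isBounded (isClosed_eq hnc continuous_const)
      ((isBounded_closedBall (x := (0 : E3)) (r := R)).subset fun x hx => ?_)
    rw [mem_closedBall, dist_zero_right]
    by_contra h
    have := hR x (le_of_not_ge h)
    rw [mem_setOf_eq] at hx
    linarith
  -- Step 1: a uniform `γ` on the contact set
  obtain ⟨γ, hγ, hKγ⟩ : ∃ γ : ℝ, 0 < γ ∧ ∀ x, ‖v x‖ = M → ⟪v x, t⟫_ℝ < -γ := by
    rcases ({x : E3 | ‖v x‖ = M} : Set E3).eq_empty_or_nonempty with hKe | hKne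
    · refine ⟨1, one_pos, fun x hx => ?_⟩
      have hx' : x ∈ ({x : E3 | ‖v x‖ = M} : Set E3) := hx
      rw [hKe] at hx'
      simp at hx'
    · obtain ⟨x₀, hx₀K, hmax⟩ := hKc.exists_isMaxOn hKne hgc.continuousOn
      have hx₀ : ‖v x₀‖ = M := hx₀K
      have hg0 : ⟪v x₀, t⟫_ℝ < 0 := hneg x₀ hx₀
      refine ⟨-(⟪v x₀, t⟫_ℝ) / 2, by linarith, fun x hx => ?_⟩
      have hle : ⟪v x, t⟫_ℝ ≤ ⟪v x₀, t⟫_ℝ := (isMaxOn_iff.1 hmax) x hx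
      linarith
  -- Step 2: `η` from the compact set `S = closedBall 0 R ∩ {-γ ≤ ⟪v, t⟫}`, on which `‖v‖ < M`
  have hSc : IsCompact (Metric.closedBall (0 : E3) R ∩ {x : E3 | -γ ≤ ⟪v x, t⟫_ℝ}) :=
    (isCompact_closedBall _ _).inter_right (isClosed_le continuous_const hgc)
  have hSlt : ∀ x ∈ Metric.closedBall (0 : E3) R ∩ {x : E3 | -γ ≤ ⟪v x, t⟫_ℝ}, ‖v x‖ < M := by
    intro x hx
    rcases (hM x).lt_or_eq with h | h
    · exact h
    · exfalso
      have h1 := hKγ x h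
      have h2 : -γ ≤ ⟪v x, t⟫_ℝ := hx.2
      linarith
  obtain ⟨η, hη, hηM, hηS⟩ : ∃ η : ℝ, 0 < η ∧ η ≤ M / 2 ∧
      ∀ x ∈ Metric.closedBall (0 : E3) R ∩ {x : E3 | -γ ≤ ⟪v x, t⟫_ℝ}, ‖v x‖ ≤ M - 2 * η := by
    rcases (Metric.closedBall (0 : E3) R ∩ {x : E3 | -γ ≤ ⟪v x, t⟫_ℝ}).eq_empty_or_nonempty with hSe | hSne
    · refine ⟨M / 2, half_pos hMpos, le_rfl, fun x hx => ?_⟩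
      rw [hSe] at hx
      simp at hx
    · obtain ⟨x₁, hx₁S, hmax⟩ := hSc.exists_isMaxOn hSne hnc.continuousOn
      have h1 : ‖v x₁‖ < M := hSlt x₁ hx₁S
      refine ⟨min (M / 2) ((M - ‖v x₁‖) / 4), lt_min (half_pos hMpos) (by linarith), min_le_left _ _,
        fun x hx => ?_⟩
      have hle : ‖v x‖ ≤ ‖v x₁‖ := (isMaxOn_iff.1 hmax) x hx
      have hmin := min_le_right (M / 2) ((M - ‖v x₁‖) / 4)
      linarith
  -- conclusion
  have hnear : ∀ x, M - η ≤ ‖v x‖ → ‖x‖ < R := by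
    intro x hx
    by_contra h'
    have := hR x (not_lt.1 h')
    linarith
  refine ⟨η, γ, R, hη, hγ, hnear, fun x hx => ?_⟩
  by_contra h
  have hlt : -γ < ⟪v x, t⟫_ℝ := by linarith [not_le.1 h]
  have hxS : x ∈ Metric.closedBall (0 : E3) R ∩ {x : E3 | -γ ≤ ⟪v x, t⟫_ℝ} :=
    ⟨by rw [mem_closedBall, dist_zero_right]; exact (hnear x hx).le, hlt.le⟩
  have := hηS x hxS
  linarith

/-- `κ⋆ > 13/200 > 0` (tree: `DepletionLadder.sharpDepletion_gt`). -/
theorem kStar_pos : 0 < kStar := by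
  have h : (13 : ℝ) / 200 < kStar := DepletionLadder.sharpDepletion_gt
  linarith

end DepletionLadder.KStar.HalfSpace

end Summit.NavierStokesRegularity.NavierStokesRegularity.Theorems

end
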